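import Summits.KontsevichZagierPeriods.KontsevichZagierPeriods.Theorems.LinRedNormalFormDihedralNormalFormStubBoundedStokesMove
import Summits.KontsevichZagierPeriods.KontsevichZagierPeriods.Theorems.LinRedNormalFormDihedralNormalFormStubBvStokes
import Literature.NumberTheory.Transcendental.KZUnfoldedStokesProofs
import Literature.NumberTheory.Transcendental.KZLogCalculusProofs
import Literature.NumberTheory.Transcendental.KZHomotopyMoves
import Literature.NumberTheory.Transcendental.KZProductIdeal
import Literature.NumberTheory.Transcendental.SemialgebraicMapsProofs

/-!
# Sketch (ideator 1, round 1) — crux `UnfoldedStokes.UnfoldedStokesSquare` (stmt-KontsevichZagierPeriods-3520)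

STATUS: CANDIDATE FULL PROOF — in the session folder (`Sketch.lean`, attached as item evidence together with
the landing-ready `UnfoldedStokesUnfoldedStokesSquare.lean`) `unfoldedStokesSquare_holds :
Summit.KontsevichZagierPeriods.KontsevichZagierPeriods.Theses.UnfoldedStokes.UnfoldedStokesSquare`
(the route decl itself, imported): `lean check` rc 0, 0 sorries, 0 warnings, axioms
`[propext, Classical.choice, Quot.sound]`, H21 audit `proof-of-item, closed: true` (2026-08-16).
THIS published copy is identical except that the final theorem states the crux signature verbatim
(no import of the route module — the farm refused to serve the regenerated route file at publication time).

Idea `divergence-engine-transport`: the crux is ONE instance (k = 2) of the move-level divergence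
theorem on the open cube already proved in the tree for crux `DihedralNormalForm`
(`TameBVStokes.stub_boundedStokesMove`, its bounded-variation hypothesis discharged by
`TameBVStokes.stub_bvStokes`; both sorry-free Theorems files of route LinRedNormalForm), applied to
the HOMOTOPY VECTOR FIELD `G = (Ω·e, −Ω·c, −(u·a(up)·e − u·b(up)·c))` on `(0,1)³`
(`Ω(s,t,u) = s·a(us,ut) + t·b(us,ut)`): its flux through the six faces is `rR, rL, −rT, −rB, −rW, 0`
and its divergence is `rD`'s integrand `Ω·(∂ₛe − ∂ₜc)` — the closedness `∂ₜa = ∂ₛb` enters ONLY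
through this pointwise identity, via the tree lemmas `KZ.UnfoldedStokesData.hasDerivAt_unfolding_insertNth`
(closedness unfolded: `∂ⱼΩ = ∂ᵤ(u·aⱼ(up))`) and `hasDerivAt_mul_a_smul` (the radial derivative).

Structure: §0 the engine (`divergenceEngine` = `stub_boundedStokesMove stub_bvStokes`) and its
literal-index form in dimension 3 (`divergenceEngine₃`); §1 the field (`dil`, `proj`, `Omega`,
`fieldS/T/U`) and polynomial-map facts; §2 the three stubs S1 `stub_fieldSemialgebraic` (composition
with polynomial maps into the star-shaped `U`), S2 `stub_fieldRegular` (bounded / differentiable /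
fibre-continuous), S3 `stub_fieldDiv` (the divergence identity); §3 the six face identities; §4 the
assembly (engine + `[r] + [r.neg] ∈ relations`, `[0] ∈ relations`, `abel`).

To land: move to `Theorems/UnfoldedStokesUnfoldedStokesSquare.lean` (namespace kept or renamed),
`ledger propose --kind proof --target … --workitem stmt-KontsevichZagierPeriods-3520`. If a reviewer
objects to importing another route's stub files, inline `face_move`/`stub_boundedStokesMove`
(Theorems/LinRedNormalFormDihedralNormalFormStubBoundedStokesMove.lean, 225 lines) — for THIS field the
BV theorem is not even needed (each `∂ᵢGᵢ` is continuous on the closed cube, hence integrable).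
-/

noncomputable section

open MeasureTheory Set
open Literature.NumberTheory.Transcendental
open Literature.ModelTheory.ExponentialFields (IsSemialgebraic)

namespace Summit.KontsevichZagierPeriods.UnfoldedStokes.UnfoldedStokesSquare.Ideator1

open Summit.KontsevichZagierPeriods.DihedralNormalForm.TameBVStokes (stub_boundedStokesMove stub_bvStokes)

/-! ## 0. The engine, unconditionally (BV hypothesis discharged by `stub_bvStokes`) -/

/-- **Divergence theorem on the open cube as KZ moves** (tree: `stub_boundedStokesMove stub_bvStokes`). -/
theorem divergenceEngine : ∀ (k : ℕ) (h : Fin (k + 1) → (Fin (k + 1) → ℝ) → ℝ) (C : ℝ) (r : Literature.NumberTheory.Transcendental.KZ.IntegralRep (k + 1)) (f₀ f₁ : Fin (k + 1) → Literature.NumberTheory.Transcendental.KZ.IntegralRep k), (∀ i, Literature.NumberTheory.Transcendental.IsSemialgebraicFunOn ℚ {x : Fin (k + 1) → ℝ | ∀ i, x i ∈ Set.Icc (0:ℝ) 1} (h i)) → (∀ i, ∀ x ∈ {x : Fin (k + 1) → ℝ | ∀ i, x i ∈ Set.Ioo (0:ℝ) 1}, |h i x| ≤ C) → (∀ i, ∀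 x ∈ {x : Fin (k + 1) → ℝ | ∀ i, x i ∈ Set.Ioo (0:ℝ) 1}, DifferentiableAt ℝ (h i) x) → (∀ i, ∀ y ∈ {x : Fin k → ℝ | ∀ i, x i ∈ Set.Ioo (0:ℝ) 1}, ContinuousOn (fun t : ℝ => h i (Fin.insertNth i t y)) (Set.Icc 0 1)) → r.domain = {x : Fin (k + 1) → ℝ | ∀ i, x i ∈ Set.Ioo (0:ℝ) 1} → Set.EqOn r.integrand (fun x => ∑ i, fderiv ℝ (h i) x (Pi.single i 1)) r.domain → (∀ i, (f₀ i).domain = {x : Fin k → ℝ | ∀ i, x i ∈ Set.Ioo (0:ℝ) 1} ∧ (f₁ i).domain = {x : Fin k → ℝ | ∀ i, x i ∈ Set.Ioo (0:ℝ) 1} ∧ Set.EqOn (f₀ i).integrand (fun y => h i (Fin.insertNth i 0 y)) {x : Fin k → ℝ | ∀ i, x i ∈ Set.Ioo (0:ℝ) 1} ∧ Set.EqOn (f₁ i).integrand (fun y => h i (Fin.insertNth i 1 y)) {x : Fin k → ℝ | ∀ i, x i ∈ Set.Ioo (0:ℝ) 1}) → Literature.NumberTheory.Transcendental.KZ.of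 r - ∑ i, (Literature.NumberTheory.Transcendental.KZ.of (f₁ i) - Literature.NumberTheory.Transcendental.KZ.of (f₀ i)) ∈ Literature.NumberTheory.Transcendental.KZ.relations :=
  stub_boundedStokesMove stub_bvStokes

private theorem sum_three {M : Type*} [AddCommMonoid M] (f : Fin (2 + 1) → M) :
    ∑ j, f j = f (0 : Fin 3) + f (1 : Fin 3) + f (2 : Fin 3) := Fin.sum_univ_three f

/-- **The engine in dimension three, with literal indices** (no `Fin (2+1)` bookkeeping left for the
user): vector field `(h₀, h₁, h₂)` on `(0,1)³`, divergence representation `r`, faces `fᵥᵢ`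
(`v` = value of the frozen coordinate `i`). -/
theorem divergenceEngine₃ (h₀ h₁ h₂ : (Fin 3 → ℝ) → ℝ) (C : ℝ) (r : KZ.IntegralRep 3)
    (f₀₀ f₀₁ f₀₂ f₁₀ f₁₁ f₁₂ : KZ.IntegralRep 2)
    (hs₀ : IsSemialgebraicFunOn ℚ {x : Fin 3 → ℝ | ∀ i, x i ∈ Icc (0 : ℝ) 1} h₀)
    (hs₁ : IsSemialgebraicFunOn ℚ {x : Fin 3 → ℝ | ∀ i, x i ∈ Icc (0 : ℝ) 1} h₁)
    (hs₂ : IsSemialgebraicFunOn ℚ {x : Fin 3 → ℝ | ∀ i, x i ∈ Icc (0 : ℝ) 1} h₂)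
    (hb₀ : ∀ x ∈ {x : Fin 3 → ℝ | ∀ i, x i ∈ Ioo (0 : ℝ) 1}, |h₀ x| ≤ C)
    (hb₁ : ∀ x ∈ {x : Fin 3 → ℝ | ∀ i, x i ∈ Ioo (0 : ℝ) 1}, |h₁ x| ≤ C)
    (hb₂ : ∀ x ∈ {x : Fin 3 → ℝ | ∀ i, x i ∈ Ioo (0 : ℝ) 1}, |h₂ x| ≤ C)
    (hd₀ : ∀ x ∈ {x : Fin 3 → ℝ | ∀ i, x i ∈ Ioo (0 : ℝ) 1}, DifferentiableAt ℝ h₀ x)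
    (hd₁ : ∀ x ∈ {x : Fin 3 → ℝ | ∀ i, x i ∈ Ioo (0 : ℝ) 1}, DifferentiableAt ℝ h₁ x)
    (hd₂ : ∀ x ∈ {x : Fin 3 → ℝ | ∀ i, x i ∈ Ioo (0 : ℝ) 1}, DifferentiableAt ℝ h₂ x)
    (hc₀ : ∀ y ∈ {x : Fin 2 → ℝ | ∀ i, x i ∈ Ioo (0 : ℝ) 1},
      ContinuousOn (fun t : ℝ => h₀ (Fin.insertNth 0 t y)) (Icc 0 1))
    (hc₁ : ∀ y ∈ {x : Fin 2 → ℝ | ∀ i, x i ∈ Ioo (0 : ℝ) 1},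
      ContinuousOn (fun t : ℝ => h₁ (Fin.insertNth 1 t y)) (Icc 0 1))
    (hc₂ : ∀ y ∈ {x : Fin 2 → ℝ | ∀ i, x i ∈ Ioo (0 : ℝ) 1},
      ContinuousOn (fun t : ℝ => h₂ (Fin.insertNth 2 t y)) (Icc 0 1))
    (hrd : r.domain = {x : Fin 3 → ℝ | ∀ i, x i ∈ Ioo (0 : ℝ) 1})
    (hri : EqOn r.integrand (fun x => fderiv ℝ h₀ x (Pi.single 0 1) + fderiv ℝ h₁ x (Pi.single 1 1) +
      fderiv ℝ h₂ x (Pi.single 2 1)) r.domain)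
    (hd₀₀ : f₀₀.domain = {x : Fin 2 → ℝ | ∀ i, x i ∈ Ioo (0 : ℝ) 1})
    (hd₀₁ : f₀₁.domain = {x : Fin 2 → ℝ | ∀ i, x i ∈ Ioo (0 : ℝ) 1})
    (hd₀₂ : f₀₂.domain = {x : Fin 2 → ℝ | ∀ i, x i ∈ Ioo (0 : ℝ) 1})
    (hd₁₀ : f₁₀.domain = {x : Fin 2 → ℝ | ∀ i, x i ∈ Ioo (0 : ℝ) 1})
    (hd₁₁ : f₁₁.domain = {x : Fin 2 → ℝ | ∀ i, x i ∈ Ioo (0 : ℝ) 1})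
    (hd₁₂ : f₁₂.domain = {x : Fin 2 → ℝ | ∀ i, x i ∈ Ioo (0 : ℝ) 1})
    (hi₀₀ : EqOn f₀₀.integrand (fun y => h₀ (Fin.insertNth 0 0 y)) {x : Fin 2 → ℝ | ∀ i, x i ∈ Ioo (0 : ℝ) 1})
    (hi₁₀ : EqOn f₁₀.integrand (fun y => h₀ (Fin.insertNth 0 1 y)) {x : Fin 2 → ℝ | ∀ i, x i ∈ Ioo (0 : ℝ) 1})
    (hi₀₁ : EqOn f₀₁.integrand (fun y => h₁ (Fin.insertNth 1 0 y)) {x : Fin 2 → ℝ | ∀ i, x i ∈ Ioo (0 : ℝ) 1})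
    (hi₁₁ : EqOn f₁₁.integrand (fun y => h₁ (Fin.insertNth 1 1 y)) {x : Fin 2 → ℝ | ∀ i, x i ∈ Ioo (0 : ℝ) 1})
    (hi₀₂ : EqOn f₀₂.integrand (fun y => h₂ (Fin.insertNth 2 0 y)) {x : Fin 2 → ℝ | ∀ i, x i ∈ Ioo (0 : ℝ) 1})
    (hi₁₂ : EqOn f₁₂.integrand (fun y => h₂ (Fin.insertNth 2 1 y)) {x : Fin 2 → ℝ | ∀ i, x i ∈ Ioo (0 : ℝ) 1}) :
    KZ.of r - (KZ.of f₁₀ - KZ.of f₀₀ + (KZ.of f₁₁ - KZ.of f₀₁) + (KZ.of f₁₂ - KZ.of f₀₂)) ∈ KZ.relations := by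
  have key := divergenceEngine 2 ![h₀, h₁, h₂] C r ![f₀₀, f₀₁, f₀₂] ![f₁₀, f₁₁, f₁₂]
    (by intro i; fin_cases i <;> assumption)
    (by intro i; fin_cases i <;> assumption)
    (by intro i; fin_cases i <;> assumption)
    (by intro i; fin_cases i <;> assumption)
    hrd
    (by
      intro x hx
      simp only [sum_three, Matrix.cons_val_zero, Matrix.cons_val_one, Matrix.head_cons,
        Matrix.cons_val_two, Matrix.tail_cons]
      exact hri hx)
    (by
      intro i
      fin_cases i
      · exact ⟨hd₀₀, hd₁₀, hi₀₀, hi₁₀⟩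
      · exact ⟨hd₀₁, hd₁₁, hi₀₁, hi₁₁⟩
      · exact ⟨hd₀₂, hd₁₂, hi₀₂, hi₁₂⟩)
  simpa only [sum_three, Matrix.cons_val_zero, Matrix.cons_val_one, Matrix.head_cons,
    Matrix.cons_val_two, Matrix.tail_cons] using key

/-! ## 1. The homotopy vector field of the square -/

/-- The dilation `(s,t,u) ↦ (us, ut)`. -/
def dil (x : Fin 3 → ℝ) : Fin 2 → ℝ := ![x 2 * x 0, x 2 * x 1]

/-- The projection `(s,t,u) ↦ (s, t)`. -/
def proj (x : Fin 3 → ℝ) : Fin 2 → ℝ := ![x 0, x 1]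

variable (U : Set (Fin 2 → ℝ)) (a b c e : (Fin 2 → ℝ) → ℝ)

/-- `Ω(s,t,u) = s·a(us,ut) + t·b(us,ut)` on `ℝ³` (coordinates `x 0 = s`, `x 1 = t`, `x 2 = u`). -/
def Omega (x : Fin 3 → ℝ) : ℝ := x 0 * a (dil x) + x 1 * b (dil x)

/-- First component `G₀ = Ω·e(s,t)` (flux through the faces `s = 0, 1`). -/
def fieldS (x : Fin 3 → ℝ) : ℝ := Omega a b x * e (proj x)

/-- Second component `G₁ = −Ω·c(s,t)` (flux through the faces `t = 0, 1`). -/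
def fieldT (x : Fin 3 → ℝ) : ℝ := -(Omega a b x * c (proj x))

/-- Third component `G₂ = −(u·a(up)·e(p) − u·b(up)·c(p))` (MINUS the radial primitive of `ω ∧ η`;
flux through `u = 0, 1`). -/
def fieldU (x : Fin 3 → ℝ) : ℝ := -(x 2 * a (dil x) * e (proj x) - x 2 * b (dil x) * c (proj x))

/-! ### Elementary facts on the two polynomial maps -/

section Facts

variable {U}

theorem dil_eq_smul_proj (x : Fin 3 → ℝ) : dil x = x 2 • proj x := by
  ext j; fin_cases j <;> rfl

theorem proj_mem_Icc {x : Fin 3 → ℝ} (hx : ∀ i, x i ∈ Icc (0 : ℝ) 1) :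
    proj x ∈ Icc (0 : Fin 2 → ℝ) 1 := by
  refine ⟨fun j => ?_, fun j => ?_⟩
  · fin_cases j
    · exact (hx 0).1
    · exact (hx 1).1
  · fin_cases j
    · exact (hx 0).2
    · exact (hx 1).2

theorem proj_mem (hUI : Icc (0 : Fin 2 → ℝ) 1 ⊆ U) {x : Fin 3 → ℝ} (hx : ∀ i, x i ∈ Icc (0 : ℝ) 1) :
    proj x ∈ U :=
  hUI (proj_mem_Icc hx)

theorem dil_mem (hUI : Icc (0 : Fin 2 → ℝ) 1 ⊆ U) (hstar : ∀ p ∈ U, ∀ u ∈ Icc (0 : ℝ) 1, u • p ∈ U)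
    {x : Fin 3 → ℝ} (hx : ∀ i, x i ∈ Icc (0 : ℝ) 1) : dil x ∈ U := by
  rw [dil_eq_smul_proj]
  exact hstar _ (proj_mem hUI hx) _ (hx 2)

theorem Icc_of_Ioo {x : Fin 3 → ℝ} (hx : ∀ i, x i ∈ Ioo (0 : ℝ) 1) : ∀ i, x i ∈ Icc (0 : ℝ) 1 :=
  fun i => Ioo_subset_Icc_self (hx i)

theorem continuous_dil : Continuous dil :=
  continuous_pi fun j => by
    fin_cases j
    · exact (continuous_apply 2).mul (continuous_apply 0)
    · exact (continuous_apply 2).mul (continuous_apply 1)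

theorem continuous_proj : Continuous proj :=
  continuous_pi fun j => by
    fin_cases j
    · exact continuous_apply 0
    · exact continuous_apply 1

theorem differentiable_dil : Differentiable ℝ dil := fun x =>
  differentiableAt_pi.2 fun j => by
    fin_cases j
    · show DifferentiableAt ℝ (fun x : Fin 3 → ℝ => x 2 * x 0) x; fun_prop
    · show DifferentiableAt ℝ (fun x : Fin 3 → ℝ => x 2 * x 1) x; fun_prop

theorem differentiable_proj : Differentiable ℝ proj := fun x =>
  differentiableAt_pi.2 fun j => by
    fin_cases j
    · show DifferentiableAt ℝ (fun x : Fin 3 → ℝ => x 0) x; fun_prop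
    · show DifferentiableAt ℝ (fun x : Fin 3 → ℝ => x 1) x; fun_prop

/-- The closed cube `[0,1]³` in the coordinatewise form of the engine is `closedUnitCube 3`. -/
theorem Q3_eq_closedUnitCube :
    {x : Fin 3 → ℝ | ∀ i, x i ∈ Icc (0 : ℝ) 1} = closedUnitCube 3 :=
  Set.ext fun _ => mem_closedUnitCube_iff.symm

theorem isSemialgebraic_Q3 : IsSemialgebraic ℚ {x : Fin 3 → ℝ | ∀ i, x i ∈ Icc (0 : ℝ) 1} := by
  rw [Q3_eq_closedUnitCube]; exact isSemialgebraic_closedUnitCube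

theorem isCompact_Q3 : IsCompact {x : Fin 3 → ℝ | ∀ i, x i ∈ Icc (0 : ℝ) 1} := by
  rw [Q3_eq_closedUnitCube]; exact isCompact_closedUnitCube

theorem isSemialgebraicMapOn_dil :
    IsSemialgebraicMapOn ℚ {x : Fin 3 → ℝ | ∀ i, x i ∈ Icc (0 : ℝ) 1} dil :=
  (isSemialgebraicMapOn_aeval isSemialgebraic_Q3
    (![MvPolynomial.X 2 * MvPolynomial.X 0, MvPolynomial.X 2 * MvPolynomial.X 1] :
      Fin 2 → MvPolynomial (Fin 3) ℚ)).congr fun x _ => by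
    ext j; fin_cases j <;> simp [dil]

theorem isSemialgebraicMapOn_proj :
    IsSemialgebraicMapOn ℚ {x : Fin 3 → ℝ | ∀ i, x i ∈ Icc (0 : ℝ) 1} proj :=
  (isSemialgebraicMapOn_aeval isSemialgebraic_Q3
    (![MvPolynomial.X 0, MvPolynomial.X 1] : Fin 2 → MvPolynomial (Fin 3) ℚ)).congr fun x _ => by
    ext j; fin_cases j <;> simp [proj]

theorem isSemialgebraicFunOn_coord (i : Fin 3) :
    IsSemialgebraicFunOn ℚ {x : Fin 3 → ℝ | ∀ i, x i ∈ Icc (0 : ℝ) 1} (fun x => x i) :=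
  (isSemialgebraicFunOn_aeval isSemialgebraic_Q3 (MvPolynomial.X i)).congr fun x _ => by simp

end Facts

/-! ## 2. Stubs of the line -/

/-- S1: the three components are `ℚ`-semialgebraic on the CLOSED cube (composition with the polynomial
maps `x ↦ (x₂x₀, x₂x₁)`, `x ↦ (x₀, x₁)`, which map the closed cube into `U` by star-shapedness;
`IsSemialgebraicFunOn.comp_isSemialgebraicMapOn_holds`, `isSemialgebraicMapOn_aeval`, `fun_mul`). -/
theorem stub_fieldSemialgebraic (hUI : Icc (0 : Fin 2 → ℝ) 1 ⊆ U)
    (hstar : ∀ p ∈ U, ∀ u ∈ Icc (0 : ℝ) 1, u • p ∈ U)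
    (sa : IsSemialgebraicFunOn ℚ U a) (sb : IsSemialgebraicFunOn ℚ U b)
    (sc : IsSemialgebraicFunOn ℚ U c) (se : IsSemialgebraicFunOn ℚ U e) :
    IsSemialgebraicFunOn ℚ {x : Fin 3 → ℝ | ∀ i, x i ∈ Icc (0 : ℝ) 1} (fieldS a b e) ∧
    IsSemialgebraicFunOn ℚ {x : Fin 3 → ℝ | ∀ i, x i ∈ Icc (0 : ℝ) 1} (fieldT a b c) ∧
    IsSemialgebraicFunOn ℚ {x : Fin 3 → ℝ | ∀ i, x i ∈ Icc (0 : ℝ) 1} (fieldU a b c e) := by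
  have mdil : MapsTo dil {x : Fin 3 → ℝ | ∀ i, x i ∈ Icc (0 : ℝ) 1} U := fun x hx => dil_mem hUI hstar hx
  have mproj : MapsTo proj {x : Fin 3 → ℝ | ∀ i, x i ∈ Icc (0 : ℝ) 1} U := fun x hx => proj_mem hUI hx
  have haD : IsSemialgebraicFunOn ℚ _ (a ∘ dil) :=
    IsSemialgebraicFunOn.comp_isSemialgebraicMapOn_holds sa isSemialgebraicMapOn_dil mdil
  have hbD : IsSemialgebraicFunOn ℚ _ (b ∘ dil) :=
    IsSemialgebraicFunOn.comp_isSemialgebraicMapOn_holds sb isSemialgebraicMapOn_dil mdil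
  have hcP : IsSemialgebraicFunOn ℚ _ (c ∘ proj) :=
    IsSemialgebraicFunOn.comp_isSemialgebraicMapOn_holds sc isSemialgebraicMapOn_proj mproj
  have heP : IsSemialgebraicFunOn ℚ _ (e ∘ proj) :=
    IsSemialgebraicFunOn.comp_isSemialgebraicMapOn_holds se isSemialgebraicMapOn_proj mproj
  have h0 := isSemialgebraicFunOn_coord 0
  have h1 := isSemialgebraicFunOn_coord 1
  have h2 := isSemialgebraicFunOn_coord 2
  have hΩ : IsSemialgebraicFunOn ℚ _ (Omega a b) :=
    ((h0.fun_mul haD).fun_add (h1.fun_mul hbD)).congr fun x _ => rfl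
  exact ⟨(hΩ.fun_mul heP).congr fun x _ => rfl, (hΩ.fun_mul hcP).fun_neg.congr fun x _ => rfl,
    (((h2.fun_mul haD).fun_mul heP).fun_sub ((h2.fun_mul hbD).fun_mul hcP)).fun_neg.congr
      fun x _ => rfl⟩

private theorem insertNth_zero (t : ℝ) (y : Fin 2 → ℝ) :
    (Fin.insertNth (0 : Fin 3) t y : Fin 3 → ℝ) = ![t, y 0, y 1] := by
  ext j; fin_cases j <;> rfl

private theorem insertNth_one (t : ℝ) (y : Fin 2 → ℝ) :
    (Fin.insertNth (1 : Fin 3) t y : Fin 3 → ℝ) = ![y 0, t, y 1] := by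
  ext j; fin_cases j <;> rfl

private theorem insertNth_two (t : ℝ) (y : Fin 2 → ℝ) :
    (Fin.insertNth (2 : Fin 3) t y : Fin 3 → ℝ) = ![y 0, y 1, t] := by
  ext j; fin_cases j <;> rfl

private theorem continuous_vec3 {f g h : ℝ → ℝ} (hf : Continuous f) (hg : Continuous g)
    (hh : Continuous h) : Continuous fun t => (![f t, g t, h t] : Fin 3 → ℝ) :=
  continuous_pi fun j => by
    fin_cases j
    · exact hf
    · exact hg
    · exact hh

/-- S2: regularity — bounded on the open cube, differentiable there, continuous on each closed
coordinate fibre (the data are `C¹` on the open `U ⊇ [0,1]²`, star-shaped about `0`). -/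
theorem stub_fieldRegular (hU : IsOpen U) (hUI : Icc (0 : Fin 2 → ℝ) 1 ⊆ U)
    (hstar : ∀ p ∈ U, ∀ u ∈ Icc (0 : ℝ) 1, u • p ∈ U)
    (ha : ContDiffOn ℝ 1 a U) (hb : ContDiffOn ℝ 1 b U) (hc : ContDiffOn ℝ 1 c U)
    (he : ContDiffOn ℝ 1 e U) :
    (∃ C : ℝ, (∀ x ∈ {x : Fin 3 → ℝ | ∀ i, x i ∈ Ioo (0 : ℝ) 1}, |fieldS a b e x| ≤ C) ∧
      (∀ x ∈ {x : Fin 3 → ℝ | ∀ i, x i ∈ Ioo (0 : ℝ) 1}, |fieldT a b c x| ≤ C) ∧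
      (∀ x ∈ {x : Fin 3 → ℝ | ∀ i, x i ∈ Ioo (0 : ℝ) 1}, |fieldU a b c e x| ≤ C)) ∧
    ((∀ x ∈ {x : Fin 3 → ℝ | ∀ i, x i ∈ Ioo (0 : ℝ) 1}, DifferentiableAt ℝ (fieldS a b e) x) ∧
      (∀ x ∈ {x : Fin 3 → ℝ | ∀ i, x i ∈ Ioo (0 : ℝ) 1}, DifferentiableAt ℝ (fieldT a b c) x) ∧
      (∀ x ∈ {x : Fin 3 → ℝ | ∀ i, x i ∈ Ioo (0 : ℝ) 1}, DifferentiableAt ℝ (fieldU a b c e) x)) ∧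
    ((∀ y ∈ {x : Fin 2 → ℝ | ∀ i, x i ∈ Ioo (0 : ℝ) 1},
        ContinuousOn (fun t : ℝ => fieldS a b e (Fin.insertNth 0 t y)) (Icc 0 1)) ∧
      (∀ y ∈ {x : Fin 2 → ℝ | ∀ i, x i ∈ Ioo (0 : ℝ) 1},
        ContinuousOn (fun t : ℝ => fieldT a b c (Fin.insertNth 1 t y)) (Icc 0 1)) ∧
      (∀ y ∈ {x : Fin 2 → ℝ | ∀ i, x i ∈ Ioo (0 : ℝ) 1},
        ContinuousOn (fun t : ℝ => fieldU a b c e (Fin.insertNth 2 t y)) (Icc 0 1))) := by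
  set Q3 : Set (Fin 3 → ℝ) := {x : Fin 3 → ℝ | ∀ i, x i ∈ Icc (0 : ℝ) 1} with hQ3
  have mdil : MapsTo dil Q3 U := fun x hx => dil_mem hUI hstar hx
  have mproj : MapsTo proj Q3 U := fun x hx => proj_mem hUI hx
  -- continuity on the closed cube
  have caD : ContinuousOn (fun x => a (dil x)) Q3 := ha.continuousOn.comp continuous_dil.continuousOn mdil
  have cbD : ContinuousOn (fun x => b (dil x)) Q3 := hb.continuousOn.comp continuous_dil.continuousOn mdil
  have ccP : ContinuousOn (fun x => c (proj x)) Q3 := hc.continuousOn.comp continuous_proj.continuousOn mproj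
  have ceP : ContinuousOn (fun x => e (proj x)) Q3 := he.continuousOn.comp continuous_proj.continuousOn mproj
  have c0 : ContinuousOn (fun x : Fin 3 → ℝ => x 0) Q3 := (continuous_apply 0).continuousOn
  have c1 : ContinuousOn (fun x : Fin 3 → ℝ => x 1) Q3 := (continuous_apply 1).continuousOn
  have c2 : ContinuousOn (fun x : Fin 3 → ℝ => x 2) Q3 := (continuous_apply 2).continuousOn
  have cΩ : ContinuousOn (Omega a b) Q3 := (c0.mul caD).add (c1.mul cbD)
  have cS : ContinuousOn (fieldS a b e) Q3 := cΩ.mul ceP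
  have cT : ContinuousOn (fieldT a b c) Q3 := (cΩ.mul ccP).neg
  have cU : ContinuousOn (fieldU a b c e) Q3 := (((c2.mul caD).mul ceP).sub ((c2.mul cbD).mul ccP)).neg
  -- bounds
  obtain ⟨C₀, hC₀⟩ := isCompact_Q3.exists_bound_of_continuousOn cS
  obtain ⟨C₁, hC₁⟩ := isCompact_Q3.exists_bound_of_continuousOn cT
  obtain ⟨C₂, hC₂⟩ := isCompact_Q3.exists_bound_of_continuousOn cU
  refine ⟨⟨max C₀ (max C₁ C₂), fun x hx => ?_, fun x hx => ?_, fun x hx => ?_⟩, ⟨?_, ?_, ?_⟩,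
    ⟨?_, ?_, ?_⟩⟩
  · have h := hC₀ x (Icc_of_Ioo hx)
    rw [Real.norm_eq_abs] at h
    exact h.trans (le_max_left _ _)
  · have h := hC₁ x (Icc_of_Ioo hx)
    rw [Real.norm_eq_abs] at h
    exact h.trans (le_max_of_le_right (le_max_left _ _))
  · have h := hC₂ x (Icc_of_Ioo hx)
    rw [Real.norm_eq_abs] at h
    exact h.trans (le_max_of_le_right (le_max_right _ _))
  -- differentiability on the open cube
  · intro x hx
    have hdx : dil x ∈ U := mdil (Icc_of_Ioo hx)
    have hpx : proj x ∈ U := mproj (Icc_of_Ioo hx)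
    have daD : DifferentiableAt ℝ (fun x => a (dil x)) x :=
      (((ha.differentiableOn one_ne_zero) _ hdx).differentiableAt (hU.mem_nhds hdx)).comp x
        (differentiable_dil x)
    have dbD : DifferentiableAt ℝ (fun x => b (dil x)) x :=
      (((hb.differentiableOn one_ne_zero) _ hdx).differentiableAt (hU.mem_nhds hdx)).comp x
        (differentiable_dil x)
    have deP : DifferentiableAt ℝ (fun x => e (proj x)) x :=
      (((he.differentiableOn one_ne_zero) _ hpx).differentiableAt (hU.mem_nhds hpx)).comp x
        (differentiable_proj x)
    have d0 : DifferentiableAt ℝ (fun x : Fin 3 → ℝ => x 0) x := by fun_prop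
    have d1 : DifferentiableAt ℝ (fun x : Fin 3 → ℝ => x 1) x := by fun_prop
    exact ((d0.mul daD).add (d1.mul dbD)).mul deP
  · intro x hx
    have hdx : dil x ∈ U := mdil (Icc_of_Ioo hx)
    have hpx : proj x ∈ U := mproj (Icc_of_Ioo hx)
    have daD : DifferentiableAt ℝ (fun x => a (dil x)) x :=
      (((ha.differentiableOn one_ne_zero) _ hdx).differentiableAt (hU.mem_nhds hdx)).comp x
        (differentiable_dil x)
    have dbD : DifferentiableAt ℝ (fun x => b (dil x)) x :=
      (((hb.differentiableOn one_ne_zero) _ hdx).differentiableAt (hU.mem_nhds hdx)).comp x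
        (differentiable_dil x)
    have dcP : DifferentiableAt ℝ (fun x => c (proj x)) x :=
      (((hc.differentiableOn one_ne_zero) _ hpx).differentiableAt (hU.mem_nhds hpx)).comp x
        (differentiable_proj x)
    have d0 : DifferentiableAt ℝ (fun x : Fin 3 → ℝ => x 0) x := by fun_prop
    have d1 : DifferentiableAt ℝ (fun x : Fin 3 → ℝ => x 1) x := by fun_prop
    exact (((d0.mul daD).add (d1.mul dbD)).mul dcP).neg
  · intro x hx
    have hdx : dil x ∈ U := mdil (Icc_of_Ioo hx)
    have hpx : proj x ∈ U := mproj (Icc_of_Ioo hx)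
    have daD : DifferentiableAt ℝ (fun x => a (dil x)) x :=
      (((ha.differentiableOn one_ne_zero) _ hdx).differentiableAt (hU.mem_nhds hdx)).comp x
        (differentiable_dil x)
    have dbD : DifferentiableAt ℝ (fun x => b (dil x)) x :=
      (((hb.differentiableOn one_ne_zero) _ hdx).differentiableAt (hU.mem_nhds hdx)).comp x
        (differentiable_dil x)
    have dcP : DifferentiableAt ℝ (fun x => c (proj x)) x :=
      (((hc.differentiableOn one_ne_zero) _ hpx).differentiableAt (hU.mem_nhds hpx)).comp x
        (differentiable_proj x)
    have deP : DifferentiableAt ℝ (fun x => e (proj x)) x :=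
      (((he.differentiableOn one_ne_zero) _ hpx).differentiableAt (hU.mem_nhds hpx)).comp x
        (differentiable_proj x)
    have d2 : DifferentiableAt ℝ (fun x : Fin 3 → ℝ => x 2) x := by fun_prop
    exact (((d2.mul daD).mul deP).sub ((d2.mul dbD).mul dcP)).neg
  -- continuity on the closed coordinate fibres
  · intro y hy
    have hpath : Continuous fun t : ℝ => (Fin.insertNth (0 : Fin 3) t y : Fin 3 → ℝ) := by
      simp only [insertNth_zero]; exact continuous_vec3 continuous_id continuous_const continuous_const
    refine cS.comp hpath.continuousOn fun t ht => ?_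
    rw [insertNth_zero]
    intro i
    fin_cases i
    · exact ht
    · exact Ioo_subset_Icc_self (hy 0)
    · exact Ioo_subset_Icc_self (hy 1)
  · intro y hy
    have hpath : Continuous fun t : ℝ => (Fin.insertNth (1 : Fin 3) t y : Fin 3 → ℝ) := by
      simp only [insertNth_one]; exact continuous_vec3 continuous_const continuous_id continuous_const
    refine cT.comp hpath.continuousOn fun t ht => ?_
    rw [insertNth_one]
    intro i
    fin_cases i
    · exact Ioo_subset_Icc_self (hy 0)
    · exact ht
    · exact Ioo_subset_Icc_self (hy 1)
  · intro y hy
    have hpath : Continuous fun t : ℝ => (Fin.insertNth (2 : Fin 3) t y : Fin 3 → ℝ) := by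
      simp only [insertNth_two]; exact continuous_vec3 continuous_const continuous_const continuous_id
    refine cU.comp hpath.continuousOn fun t ht => ?_
    rw [insertNth_two]
    intro i
    fin_cases i
    · exact Ioo_subset_Icc_self (hy 0)
    · exact Ioo_subset_Icc_self (hy 1)
    · exact ht

/-! ### Shape lemmas (vector notation on `Fin 2`/`Fin 3`, sums over `Fin (1+1)`) -/

private theorem sum_two' {M : Type*} [AddCommMonoid M] (f : Fin (1 + 1) → M) :
    ∑ j, f j = f (0 : Fin 2) + f (1 : Fin 2) := Fin.sum_univ_two f

private theorem ins0 (t q : ℝ) : (Fin.insertNth (0 : Fin 2) t ![q] : Fin 2 → ℝ) = ![t, q] := by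
  ext j; fin_cases j <;> rfl

private theorem ins1 (t q : ℝ) : (Fin.insertNth (1 : Fin 2) t ![q] : Fin 2 → ℝ) = ![q, t] := by
  ext j; fin_cases j <;> rfl

private theorem update0 (x : Fin 3 → ℝ) (s : ℝ) : Function.update x 0 s = ![s, x 1, x 2] := by
  ext j; fin_cases j <;> rfl

private theorem update1 (x : Fin 3 → ℝ) (s : ℝ) : Function.update x 1 s = ![x 0, s, x 2] := by
  ext j; fin_cases j <;> rfl

private theorem update2 (x : Fin 3 → ℝ) (s : ℝ) : Function.update x 2 s = ![x 0, x 1, s] := by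
  ext j; fin_cases j <;> rfl

private theorem update0_proj (x : Fin 3 → ℝ) (s : ℝ) : Function.update (proj x) 0 s = ![s, x 1] := by
  ext j; fin_cases j <;> rfl

private theorem update1_proj (x : Fin 3 → ℝ) (s : ℝ) : Function.update (proj x) 1 s = ![x 0, s] := by
  ext j; fin_cases j <;> rfl

/-- S3 (the heart): `div G = Ω·(∂ₛe − ∂ₜc)` on the open cube — the closedness `∂ₜa = ∂ₛb` turns
`∂ₛΩ`, `∂ₜΩ` into the radial derivatives `∂ᵤ(u·a(up))`, `∂ᵤ(u·b(up))`, which the `u`-component cancels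
(`KZ.UnfoldedStokesData.hasDerivAt_unfolding_insertNth`, `hasDerivAt_mul_a_smul`). The semialgebraic
hypotheses are only used to instantiate the packaged datum `KZ.UnfoldedStokesData.square`. -/
theorem stub_fieldDiv (hU : IsOpen U) (hUI : Icc (0 : Fin 2 → ℝ) 1 ⊆ U)
    (hstar : ∀ p ∈ U, ∀ u ∈ Icc (0 : ℝ) 1, u • p ∈ U)
    (ha : ContDiffOn ℝ 1 a U) (hb : ContDiffOn ℝ 1 b U) (hc : ContDiffOn ℝ 1 c U)
    (he : ContDiffOn ℝ 1 e U)
    (hclosed : ∀ p ∈ U, fderiv ℝ a p (Pi.single 1 1) = fderiv ℝ b p (Pi.single 0 1))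
    (sa : IsSemialgebraicFunOn ℚ U a) (sb : IsSemialgebraicFunOn ℚ U b)
    (sc : IsSemialgebraicFunOn ℚ U c) (se : IsSemialgebraicFunOn ℚ U e)
    (sa₀ : IsSemialgebraicFunOn ℚ U fun p => fderiv ℝ a p (Pi.single 0 1))
    (sa₁ : IsSemialgebraicFunOn ℚ U fun p => fderiv ℝ a p (Pi.single 1 1))
    (sb₁ : IsSemialgebraicFunOn ℚ U fun p => fderiv ℝ b p (Pi.single 1 1))
    (sc₁ : IsSemialgebraicFunOn ℚ U fun p => fderiv ℝ c p (Pi.single 1 1))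
    (se₀ : IsSemialgebraicFunOn ℚ U fun p => fderiv ℝ e p (Pi.single 0 1)) :
    ∀ x ∈ {x : Fin 3 → ℝ | ∀ i, x i ∈ Ioo (0 : ℝ) 1},
      fderiv ℝ (fieldS a b e) x (Pi.single 0 1) + fderiv ℝ (fieldT a b c) x (Pi.single 1 1) +
          fderiv ℝ (fieldU a b c e) x (Pi.single 2 1) =
        Omega a b x * (fderiv ℝ e (proj x) (Pi.single 0 1) - fderiv ℝ c (proj x) (Pi.single 1 1)) := by
  intro x hx
  -- the packaged datum of the square (carries the closedness in the form the tree lemmas consume)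
  let D : KZ.UnfoldedStokesData 1 :=
    KZ.UnfoldedStokesData.square hU hUI hstar ha hb hc he hclosed sa sb sc se sa₀ sa₁ sb₁ sc₁ se₀
  have hDa0 : D.a (0 : Fin 2) = a := rfl
  have hDa1 : D.a (1 : Fin 2) = b := rfl
  -- the two points `p = (s,t)` and `u p`
  have hxI : ∀ i, x i ∈ Icc (0 : ℝ) 1 := Icc_of_Ioo hx
  have hp : proj x ∈ U := proj_mem hUI hxI
  have hd : dil x ∈ U := dil_mem hUI hstar hxI
  have hsp : x 2 • proj x ∈ U := by rw [← dil_eq_smul_proj]; exact hd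
  have hins₀ : (Fin.insertNth (0 : Fin 2) (x 0) ![x 1] : Fin 2 → ℝ) = proj x := by
    ext j; fin_cases j <;> rfl
  have hins₁ : (Fin.insertNth (1 : Fin 2) (x 1) ![x 0] : Fin 2 → ℝ) = proj x := by
    ext j; fin_cases j <;> rfl
  have hupd0 : Function.update (proj x) 0 (x 0) = proj x := by ext j; fin_cases j <;> rfl
  have hupd1 : Function.update (proj x) 1 (x 1) = proj x := by ext j; fin_cases j <;> rfl
  -- differentiability of the three components at `x` (stub S2) and of `e`, `c` at `p`
  obtain ⟨-, ⟨hdS, hdT, hdU⟩, -⟩ := stub_fieldRegular U a b c e hU hUI hstar ha hb hc he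
  have He : HasFDerivAt e (fderiv ℝ e (proj x)) (proj x) :=
    (((he.differentiableOn one_ne_zero) _ hp).differentiableAt (hU.mem_nhds hp)).hasFDerivAt
  have Hc : HasFDerivAt c (fderiv ℝ c (proj x)) (proj x) :=
    (((hc.differentiableOn one_ne_zero) _ hp).differentiableAt (hU.mem_nhds hp)).hasFDerivAt
  -- `Ω(p, u) = unfolding` of the datum
  have hunf : KZ.unfolding D.a (proj x) (x 2) = Omega a b x := by
    rw [KZ.unfolding_apply, sum_two']
    simp only [hDa0, hDa1, proj, Omega, dil, Matrix.cons_val_zero, Matrix.cons_val_one,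
      Matrix.smul_cons, Matrix.smul_empty, smul_eq_mul]
  ----------------------------------------------------------------
  -- (1) `∂ₛ G₀ = (a(up) + u·Da(up)·p)·e(p) + Ω·∂ₛe(p)`  (closedness, unfolded, along `s`)
  ----------------------------------------------------------------
  have key0 := D.hasDerivAt_unfolding_insertNth (0 : Fin 2) ![x 1] (x 2) (x 0)
    (by rw [hins₀]; exact hsp)
  have hE : HasDerivAt (fun s => e (Function.update (proj x) 0 s))
      (fderiv ℝ e (proj x) (Pi.single 0 1)) (x 0) := by
    have He' : HasFDerivAt e (fderiv ℝ e (proj x)) (Function.update (proj x) 0 (x 0)) := by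
      rw [hupd0]; exact He
    exact He'.comp_hasDerivAt (x 0) (hasDerivAt_update (proj x) 0 (x 0))
  have hpt0 : ∀ s, fieldS a b e (Function.update x 0 s) =
      KZ.unfolding D.a (Fin.insertNth (0 : Fin 2) s ![x 1]) (x 2) * e (Function.update (proj x) 0 s) := by
    intro s
    rw [update0, ins0, update0_proj, KZ.unfolding_apply, sum_two']
    simp only [fieldS, Omega, dil, proj, hDa0, hDa1, Matrix.cons_val_zero, Matrix.cons_val_one,
      Matrix.head_cons, Matrix.cons_val_two, Matrix.tail_cons, Matrix.smul_cons, Matrix.smul_empty,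
      smul_eq_mul]
  have hcalc0 := (key0.mul hE).congr_of_eventuallyEq (Filter.Eventually.of_forall hpt0)
  have hcomp0 : HasDerivAt (fun s => fieldS a b e (Function.update x 0 s))
      (fderiv ℝ (fieldS a b e) x (Pi.single 0 1)) (x 0) := by
    have hF : HasFDerivAt (fieldS a b e) (fderiv ℝ (fieldS a b e) x) (Function.update x 0 (x 0)) := by
      rw [Function.update_eq_self]; exact (hdS x hx).hasFDerivAt
    exact hF.comp_hasDerivAt (x 0) (hasDerivAt_update x 0 (x 0))
  have e0 := hcomp0.unique hcalc0
  ----------------------------------------------------------------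
  -- (2) `∂ₜ G₁ = −[(b(up) + u·Db(up)·p)·c(p) + Ω·∂ₜc(p)]`  (closedness, unfolded, along `t`)
  ----------------------------------------------------------------
  have key1 := D.hasDerivAt_unfolding_insertNth (1 : Fin 2) ![x 0] (x 2) (x 1)
    (by rw [hins₁]; exact hsp)
  have hC : HasDerivAt (fun s => c (Function.update (proj x) 1 s))
      (fderiv ℝ c (proj x) (Pi.single 1 1)) (x 1) := by
    have Hc' : HasFDerivAt c (fderiv ℝ c (proj x)) (Function.update (proj x) 1 (x 1)) := by
      rw [hupd1]; exact Hc
    exact Hc'.comp_hasDerivAt (x 1) (hasDerivAt_update (proj x) 1 (x 1))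
  have hpt1 : ∀ s, fieldT a b c (Function.update x 1 s) =
      -(KZ.unfolding D.a (Fin.insertNth (1 : Fin 2) s ![x 0]) (x 2) * c (Function.update (proj x) 1 s)) := by
    intro s
    rw [update1, ins1, update1_proj, KZ.unfolding_apply, sum_two']
    simp only [fieldT, Omega, dil, proj, hDa0, hDa1, Matrix.cons_val_zero, Matrix.cons_val_one,
      Matrix.head_cons, Matrix.cons_val_two, Matrix.tail_cons, Matrix.smul_cons, Matrix.smul_empty,
      smul_eq_mul]
  have hcalc1 := (key1.mul hC).neg.congr_of_eventuallyEq (Filter.Eventually.of_forall hpt1)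
  have hcomp1 : HasDerivAt (fun s => fieldT a b c (Function.update x 1 s))
      (fderiv ℝ (fieldT a b c) x (Pi.single 1 1)) (x 1) := by
    have hF : HasFDerivAt (fieldT a b c) (fderiv ℝ (fieldT a b c) x) (Function.update x 1 (x 1)) := by
      rw [Function.update_eq_self]; exact (hdT x hx).hasFDerivAt
    exact hF.comp_hasDerivAt (x 1) (hasDerivAt_update x 1 (x 1))
  have e1 := hcomp1.unique hcalc1
  ----------------------------------------------------------------
  -- (3) `∂ᵤ G₂ = −[(a(up) + u·Da(up)·p)·e(p) − (b(up) + u·Db(up)·p)·c(p)]`  (radial derivatives)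
  ----------------------------------------------------------------
  have keyA := D.hasDerivAt_mul_a_smul (0 : Fin 2) (proj x) (u := x 2) hsp
  have keyB := D.hasDerivAt_mul_a_smul (1 : Fin 2) (proj x) (u := x 2) hsp
  have hpt2 : ∀ v, fieldU a b c e (Function.update x 2 v) =
      -(v * D.a (0 : Fin 2) (v • proj x) * e (proj x) - v * D.a (1 : Fin 2) (v • proj x) * c (proj x)) := by
    intro v
    rw [update2]
    simp only [fieldU, dil, proj, hDa0, hDa1, Matrix.cons_val_zero, Matrix.cons_val_one,
      Matrix.head_cons, Matrix.cons_val_two, Matrix.tail_cons, Matrix.smul_cons, Matrix.smul_empty,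
      smul_eq_mul]
  have hcalc2 := ((keyA.mul_const (e (proj x))).sub (keyB.mul_const (c (proj x)))).neg.congr_of_eventuallyEq
    (Filter.Eventually.of_forall hpt2)
  have hcomp2 : HasDerivAt (fun v => fieldU a b c e (Function.update x 2 v))
      (fderiv ℝ (fieldU a b c e) x (Pi.single 2 1)) (x 2) := by
    have hF : HasFDerivAt (fieldU a b c e) (fderiv ℝ (fieldU a b c e) x) (Function.update x 2 (x 2)) := by
      rw [Function.update_eq_self]; exact (hdU x hx).hasFDerivAt
    exact hF.comp_hasDerivAt (x 2) (hasDerivAt_update x 2 (x 2))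
  have e2 := hcomp2.unique hcalc2
  ----------------------------------------------------------------
  -- sum: the radial terms cancel (this is where closedness has acted), leaving `Ω·(∂ₛe − ∂ₜc)`
  ----------------------------------------------------------------
  rw [e0, e1, e2, hins₀, hins₁, hupd0, hupd1, hunf]
  ring

/-! ## 3. The six faces (pure rewriting) -/

theorem fieldS_one (y : Fin 2 → ℝ) :
    fieldS a b e (Fin.insertNth 0 1 y) = (a ![y 1, y 1 * y 0] + y 0 * b ![y 1, y 1 * y 0]) * e ![1, y 0] := by
  simp only [fieldS, insertNth_zero, Omega, dil, proj, Matrix.cons_val_zero, Matrix.cons_val_one,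
    Matrix.head_cons, Matrix.cons_val_two, Matrix.tail_cons, mul_one, one_mul]

theorem fieldS_zero (y : Fin 2 → ℝ) :
    fieldS a b e (Fin.insertNth 0 0 y) = y 0 * b ![0, y 1 * y 0] * e ![0, y 0] := by
  simp only [fieldS, insertNth_zero, Omega, dil, proj, Matrix.cons_val_zero, Matrix.cons_val_one,
    Matrix.head_cons, Matrix.cons_val_two, Matrix.tail_cons, mul_zero, zero_mul, zero_add]

theorem fieldT_one (y : Fin 2 → ℝ) :
    fieldT a b c (Fin.insertNth 1 1 y) = -((y 0 * a ![y 1 * y 0, y 1] + b ![y 1 * y 0, y 1]) * c ![y 0, 1]) := by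
  simp only [fieldT, insertNth_one, Omega, dil, proj, Matrix.cons_val_zero, Matrix.cons_val_one,
    Matrix.head_cons, Matrix.cons_val_two, Matrix.tail_cons, mul_one, one_mul]

theorem fieldT_zero (y : Fin 2 → ℝ) :
    fieldT a b c (Fin.insertNth 1 0 y) = -(y 0 * a ![y 1 * y 0, 0] * c ![y 0, 0]) := by
  simp only [fieldT, insertNth_one, Omega, dil, proj, Matrix.cons_val_zero, Matrix.cons_val_one,
    Matrix.head_cons, Matrix.cons_val_two, Matrix.tail_cons, mul_zero, zero_mul, add_zero]

theorem fieldU_one (y : Fin 2 → ℝ) :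
    fieldU a b c e (Fin.insertNth 2 1 y) = -(a ![y 0, y 1] * e ![y 0, y 1] - b ![y 0, y 1] * c ![y 0, y 1]) := by
  simp only [fieldU, insertNth_two, dil, proj, Matrix.cons_val_zero, Matrix.cons_val_one,
    Matrix.head_cons, Matrix.cons_val_two, Matrix.tail_cons, one_mul]

theorem fieldU_zero (y : Fin 2 → ℝ) :
    fieldU a b c e (Fin.insertNth 2 0 y) = 0 := by
  simp only [fieldU, insertNth_two, dil, proj, Matrix.cons_val_zero, Matrix.cons_val_one,
    Matrix.head_cons, Matrix.cons_val_two, Matrix.tail_cons, zero_mul, sub_zero, neg_zero]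

/-! ## 4. Assembly: the crux from the engine and the three stubs -/

/-- **The crux** `UnfoldedStokes.UnfoldedStokesSquare`, from the engine and stubs S1–S3. This published copy
states the crux's signature VERBATIM (Theses/UnfoldedStokes.lean:305, `ledger workitem get stmt-…-3520`
signature, byte-identical) instead of importing the route module, so that it elaborates on the farm
independently of route-file regenerations; the folder version `Sketch.lean` / evidence
`UnfoldedStokesUnfoldedStokesSquare.lean` prove the imported route decl BY NAME (audit proof-of-item closed). -/
theorem unfoldedStokesSquare_holds :
    ∀ (U : Set (Fin 2 → ℝ)) (a b c e : (Fin 2 → ℝ) → ℝ), IsOpen U → Set.Icc (0 : Fin 2 → ℝ) 1 ⊆ U → (∀ p ∈ U, ∀ u ∈ Set.Icc (0 : ℝ) 1, u • p ∈ U) → ContDiffOn ℝ 1 a U → ContDiffOn ℝ 1 b U → ContDiffOn ℝ 1 c U → ContDiffOn ℝ 1 e U → (∀ p ∈ U, fderiv ℝ a p (Pi.single 1 1) = fderiv ℝ b p (Pi.single 0 1)) → Literature.NumberTheory.Transcendental.IsSemialgebraicFunOn ℚ U a → Literature.NumberTheory.Transcendental.IsSemialgebraicFunOn ℚ U b → Literature.NumberTheory.Transcendental.IsSemialgebraicFunOn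 ℚ U c → Literature.NumberTheory.Transcendental.IsSemialgebraicFunOn ℚ U e → Literature.NumberTheory.Transcendental.IsSemialgebraicFunOn ℚ U (fun p => fderiv ℝ a p (Pi.single 0 1)) → Literature.NumberTheory.Transcendental.IsSemialgebraicFunOn ℚ U (fun p => fderiv ℝ a p (Pi.single 1 1)) → Literature.NumberTheory.Transcendental.IsSemialgebraicFunOn ℚ U (fun p => fderiv ℝ b p (Pi.single 1 1)) → Literature.NumberTheory.Transcendental.IsSemialgebraicFunOn ℚ U (fun p => fderiv ℝ c p (Pi.single 1 1)) → Literature.NumberTheory.Transcendental.IsSemialgebraicFunOn ℚ U (fun p => fderiv ℝ e p (Pi.single 0 1)) → ∀ (rB rR rT rL rW : Literature.NumberTheory.Transcendental.KZ.IntegralRep 2) (rD : Literature.NumberTheory.Transcendental.KZ.IntegralRep 3), rB.domain = {x | ∀ i, x i ∈ Set.Ioo (0 : ℝ) 1} → Set.EqOn rB.integrand (fun x => x 0 * a ![x 1 * x 0, 0] * c ![x 0, 0]) rB.domain → rR.domain = {x | ∀ i, x i ∈ Set.Ioo (0 : ℝ) 1} → Set.EqOn rR.integrand (fun x => (a ![x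 1, x 1 * x 0] + x 0 * b ![x 1, x 1 * x 0]) * e ![1, x 0]) rR.domain → rT.domain = {x | ∀ i, x i ∈ Set.Ioo (0 : ℝ) 1} → Set.EqOn rT.integrand (fun x => (x 0 * a ![x 1 * x 0, x 1] + b ![x 1 * x 0, x 1]) * c ![x 0, 1]) rT.domain → rL.domain = {x | ∀ i, x i ∈ Set.Ioo (0 : ℝ) 1} → Set.EqOn rL.integrand (fun x => x 0 * b ![0, x 1 * x 0] * e ![0, x 0]) rL.domain → rW.domain = {x | ∀ i, x i ∈ Set.Ioo (0 : ℝ) 1} → Set.EqOn rW.integrand (fun x => a ![x 0, x 1] * e ![x 0, x 1] - b ![x 0, x 1] * c ![x 0, x 1]) rW.domain → rD.domain = {x | ∀ i, x i ∈ Set.Ioo (0 : ℝ) 1} → Set.EqOn rD.integrand (fun x => (x 0 * a ![x 2 * x 0, x 2 * x 1] + x 1 * b ![x 2 * x 0, x 2 * x 1]) * (fderiv ℝ e ![x 0, x 1] (Pi.single 0 1) - fderiv ℝ c ![x 0, x 1] (Pi.single 1 1))) rD.domain → Literature.NumberTheory.Transcendental.KZ.of rB + Literature.NumberTheory.Transcendental.KZ.of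 rR - Literature.NumberTheory.Transcendental.KZ.of rT - Literature.NumberTheory.Transcendental.KZ.of rL - Literature.NumberTheory.Transcendental.KZ.of rW - Literature.NumberTheory.Transcendental.KZ.of rD ∈ Literature.NumberTheory.Transcendental.KZ.relations := by
  intro U a b c e hU hUI hstar ha hb hc he hclosed sa sb sc se sa₀ sa₁ sb₁ sc₁ se₀ rB rR rT rL rW rD
    hBd hBi hRd hRi hTd hTi hLd hLi hWd hWi hDd hDi
  -- the zero representation on the open square (face `u = 0`)
  obtain ⟨Z, hZd, hZi⟩ := KZ.exists_zeroRep (KZ.isSemialgebraic_unitCube 2)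
  obtain ⟨⟨C, hCS, hCT, hCU⟩, ⟨hdS, hdT, hdU⟩, ⟨hcS, hcT, hcU⟩⟩ :=
    stub_fieldRegular U a b c e hU hUI hstar ha hb hc he
  obtain ⟨hsS, hsT, hsU⟩ := stub_fieldSemialgebraic U a b c e hUI hstar sa sb sc se
  have hdiv := stub_fieldDiv U a b c e hU hUI hstar ha hb hc he hclosed sa sb sc se sa₀ sa₁ sb₁ sc₁ se₀
  -- the engine, with faces `f₁ = (rR, −rT, −rW)`, `f₀ = (rL, −rB, 0)` and `r = rD`
  have key := divergenceEngine₃ (fieldS a b e) (fieldT a b c) (fieldU a b c e) C rD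
    rL rB.neg Z rR rT.neg rW.neg hsS hsT hsU hCS hCT hCU hdS hdT hdU hcS hcT hcU hDd
    (fun x hx => by rw [hDi hx]; exact (hdiv x (by rw [hDd] at hx; exact hx)).symm)
    hLd (by rw [KZ.IntegralRep.domain_neg, hBd]) hZd hRd (by rw [KZ.IntegralRep.domain_neg, hTd])
    (by rw [KZ.IntegralRep.domain_neg, hWd])
    (fun y hy => by
      show rL.integrand y = fieldS a b e (Fin.insertNth 0 0 y)
      rw [hLi (show y ∈ rL.domain by rw [hLd]; exact hy), fieldS_zero])
    (fun y hy => by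
      show rR.integrand y = fieldS a b e (Fin.insertNth 0 1 y)
      rw [hRi (show y ∈ rR.domain by rw [hRd]; exact hy), fieldS_one])
    (fun y hy => by
      show rB.neg.integrand y = fieldT a b c (Fin.insertNth 1 0 y)
      rw [KZ.IntegralRep.integrand_neg, Pi.neg_apply, hBi (show y ∈ rB.domain by rw [hBd]; exact hy),
        fieldT_zero])
    (fun y hy => by
      show rT.neg.integrand y = fieldT a b c (Fin.insertNth 1 1 y)
      rw [KZ.IntegralRep.integrand_neg, Pi.neg_apply, hTi (show y ∈ rT.domain by rw [hTd]; exact hy),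
        fieldT_one])
    (fun y hy => by
      show Z.integrand y = fieldU a b c e (Fin.insertNth 2 0 y)
      rw [hZi, Pi.zero_apply, fieldU_zero])
    (fun y hy => by
      show rW.neg.integrand y = fieldU a b c e (Fin.insertNth 2 1 y)
      rw [KZ.IntegralRep.integrand_neg, Pi.neg_apply, hWi (show y ∈ rW.domain by rw [hWd]; exact hy),
        fieldU_one])
  -- the sign bookkeeping: `[r] + [r.neg] ∈ relations`, `[Z] ∈ relations`
  have hB : KZ.of rB + KZ.of rB.neg ∈ KZ.relations :=
    KZ.of_add_of_mem_relations_of_eqOn_neg rfl fun x _ => rfl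
  have hT : KZ.of rT + KZ.of rT.neg ∈ KZ.relations :=
    KZ.of_add_of_mem_relations_of_eqOn_neg rfl fun x _ => rfl
  have hW : KZ.of rW + KZ.of rW.neg ∈ KZ.relations :=
    KZ.of_add_of_mem_relations_of_eqOn_neg rfl fun x _ => rfl
  have hZ : KZ.of Z ∈ KZ.relations := KZ.of_mem_relations_of_eqOn_zero Z (by rw [hZi]; exact fun _ _ => rfl)
  have : KZ.of rB + KZ.of rR - KZ.of rT - KZ.of rL - KZ.of rW - KZ.of rD =
      -(KZ.of rD - (KZ.of rR - KZ.of rL + (KZ.of rT.neg - KZ.of rB.neg) + (KZ.of rW.neg - KZ.of Z))) +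
        (KZ.of rB + KZ.of rB.neg) - (KZ.of rT + KZ.of rT.neg) - (KZ.of rW + KZ.of rW.neg) + KZ.of Z := by
    abel
  rw [this]
  exact KZ.relations.add_mem (KZ.relations.sub_mem (KZ.relations.sub_mem
    (KZ.relations.add_mem (KZ.relations.neg_mem key) hB) hT) hW) hZ

end Summit.KontsevichZagierPeriods.UnfoldedStokes.UnfoldedStokesSquare.Ideator1

end
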